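import Literature.MathematicalPhysics.KineticTheory.DiPernaLionsCollisionTermsProofs
import Literature.MathematicalPhysics.KineticTheory.DiPernaLionsExtractionProofs
import HarnessLib

/-!
# The extraction step of DiPerna–Lions' weak stability: discharges

Topic: MathematicalPhysics / KineticTheory. With the weak compactness of the collision terms
(`diPernaLions_approx_collisionTerms_weaklyCompact_holds`, CIP 1994 Lemma 5.3.7) proved, the two
named facts above it on the spine of `diperna_lions` follow from the assembly theorems already in
the tree: the time equicontinuity of the approximating sequence
(`diPernaLions_approx_equicontinuous`, via `diPernaLions_approx_equicontinuous_of`) and the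
extraction of a weakly convergent subsequence with its limit
(`diPernaLions_extraction`, via `diPernaLions_extraction_of_equicontinuous`, which uses the
Dunford–Pettis theorem `dunfordPettis_exists_subseq_holds`). Everything is proved; theorems only.

## References

* C. Cercignani, R. Illner, M. Pulvirenti, *The Mathematical Theory of Dilute Gases*, Springer
  (1994), §5.3 Steps 8–10, pp. 147–150.
* R. J. DiPerna, P.-L. Lions, Ann. of Math. 130 (1989), §IV.
-/

namespace Literature.MathematicalPhysics.KineticTheory

universe u

/-- **Discharge of `diPernaLions_approx_equicontinuous`** (CIP 1994 §5.3 Step 10: the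
approximating sequence is equicontinuous in time with values in `L¹`). [cite: CIPDiluteGases1994, §5.3 Step 10 (p. 150)] -/
theorem diPernaLions_approx_equicontinuous_holds : diPernaLions_approx_equicontinuous.{u} :=
  diPernaLions_approx_equicontinuous_of diPernaLions_approx_collisionTerms_weaklyCompact_holds

/-- **Discharge of `diPernaLions_extraction`** (CIP 1994 §5.3 Steps 8–10; DiPerna–Lions 1989 §IV:
a subsequence of the approximating sequence converges weakly in `L¹((0,T) × ℝ^d × ℝ^d)` for all
`T`, to a limit in the DiPerna–Lions class). [cite: CIPDiluteGases1994, §5.3 Steps 8–10 (pp. 147–150)] -/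
theorem diPernaLions_extraction_holds : diPernaLions_extraction.{u} :=
  diPernaLions_extraction_of_equicontinuous diPernaLions_approx_equicontinuous_holds

end Literature.MathematicalPhysics.KineticTheory
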